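import Literature.Probability.RandomPlanarGeometry.SAWStripTMInvJoin3
import HarnessLib

/-!
# Completion of the strip transfer matrix: the final strand (soundness, part 11)

Topic `Literature/Probability/RandomPlanarGeometry` (soundness of `SAWStripTM.lean`, part 11).
When a micro-step answers `complete`, the ghost family consists of a single strand running from
the virtual source to the virtual sink: the `othersClosed` test guarantees that no other strand
end survives (every real end is a coded frontier cell, by the invariant), and `gapsOK` that every
internal column gap has been crossed at least twice. This file packages the outcome as
`Final l r₀ cs n ν` for the strand `ν = finalStrand (gstep …)` oriented from source to sink.

## References

* I. Jensen, J. Phys. A 37 (2004) 11521–11529, §2.1.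
* D. E. Knuth, TAOCP 4A (2011), §7.1.4.
-/

namespace Literature.Probability.RandomPlanarGeometry.SAW

namespace StripTM

variable {l r0 : ℕ} {cs : List Bool} {u : ℕ} {σ : State} {S : List (List XCell)}

/-! ### Decoding the completion tests -/

/-- `othersClosed` unfolded: outside `ex` there is no strand end. [folklore] -/
theorem not_stop_of_othersClosed {slots : List Code} {ex : List ℕ} (h : othersClosed slots ex = true)
    {i : ℕ} (hi : i ∉ ex) {m : Mate} (hm : slots[i]? = some (Code.stop m)) : False := by
  rw [othersClosed, List.all_eq_true] at h
  have := h (Code.stop m, i) (List.mem_zipIdx_iff_getElem?.2 hm)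
  simp [Code.noEnd, hi] at this

/-- `gapsOK` unfolded. [folklore] -/
theorem two_le_of_gapsOK {gaps : List ℕ} (h : gapsOK gaps = true) {k g : ℕ} (hk : gaps[k]? = some g) : 2 ≤ g := by
  rw [gapsOK, List.all_eq_true] at h
  have := h g (List.mem_of_getElem? hk)
  simpa using this

/-- `completeIf b gaps = complete` forces both tests. [folklore] -/
theorem completeIf_eq_complete {b : Bool} {gaps : List ℕ} (h : completeIf b gaps = .complete) :
    b = true ∧ gapsOK gaps = true := by
  unfold completeIf at h
  revert h
  cases b <;> cases gapsOK gaps <;> simp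

/-! ### The final strand -/

/-- The strand with end `vsrc` of a family, oriented to END at `vsnk` (junk `[]`). [folklore] -/
def finalStrand (S : List (List XCell)) : List XCell :=
  match S.find? (isEnd .vsrc) with
  | some π => orientTo π .vsnk
  | none => []

/-- **What completion delivers**: a single simple strand from the virtual source to the virtual
sink through swept real cells, whose real edges are exactly the grid edges chosen by the trace,
every internal column gap being crossed at least twice. [cite: Jensen2004SAWLowerBounds, §2.1] -/
structure Final (l r0 : ℕ) (cs : List Bool) (n : ℕ) (ν : List XCell) : Prop where
  /-- simple -/
  nodup : ν.Nodup
  /-- a chain of adjacent vertices -/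
  chain : ν.IsChain (Adj l r0)
  /-- starts at the virtual source -/
  head : ν.head? = some .vsrc
  /-- ends at the virtual sink -/
  last : ν.getLast? = some .vsnk
  /-- interior vertices are real -/
  virt : ∀ x ∈ ν, isEnd x ν = false → x.IsReal
  /-- swept cells only -/
  processed : ∀ x ∈ ν, Processed l n x
  /-- the real edges are the chosen grid edges -/
  pairs_iff : ∀ p : Sym2 XCell, (p ∈ cpairs ν ∧ ∀ x ∈ p, x.IsReal) ↔
    ∃ u' < n, cs.getD u' false = true ∧ p = potEdge l u'
  /-- every internal gap crossed at least twice -/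
  gaps : ∀ k, k + 1 < l → 2 ≤ hcount l cs n (k + 1)

/-- From a family reduced to one source–sink strand to `Final`. [folklore] -/
theorem final_of_unique {n : ℕ} {S' : List (List XCell)} (hW : WF (Adj l r0) S')
    {ν₀ : List XCell} (hν₀ : ν₀ ∈ S') (hsrc : isEnd .vsrc ν₀ = true) (hsnk : isEnd .vsnk ν₀ = true)
    (huniq : ∀ π ∈ S', π = ν₀) (hproc : ∀ x ∈ cells S', Processed l n x)
    (hpairs : ∀ p : Sym2 XCell, (p ∈ pairs S' ∧ ∀ x ∈ p, x.IsReal) ↔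
      ∃ u' < n, cs.getD u' false = true ∧ p = potEdge l u')
    (hgaps : ∀ k, k + 1 < l → 2 ≤ hcount l cs n (k + 1)) :
    Final l r0 cs n (finalStrand S') := by
  have hfs : finalStrand S' = orientTo ν₀ .vsnk := by
    rw [finalStrand, hW.find?_isEnd hν₀ hsrc]
  rw [hfs]
  have hA := adj_symm l r0
  have hcells : ∀ x, x ∈ cells S' ↔ x ∈ ν₀ := by
    intro x; rw [mem_cells]
    exact ⟨fun ⟨π, hπ, hx⟩ => huniq π hπ ▸ hx, fun hx => ⟨ν₀, hν₀, hx⟩⟩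
  have hpairs' : ∀ p, p ∈ pairs S' ↔ p ∈ cpairs ν₀ := by
    intro p; rw [mem_pairs]
    exact ⟨fun ⟨π, hπ, hp⟩ => huniq π hπ ▸ hp, fun hp => ⟨ν₀, hν₀, hp⟩⟩
  have hlast : (orientTo ν₀ .vsnk).getLast? = some .vsnk := getLast?_orientTo hsnk
  have hne : XCell.vsrc ≠ XCell.vsnk := by decide
  refine ⟨nodup_orientTo (hW.nodup _ hν₀) _, isChain_orientTo hA (hW.chain _ hν₀) _, ?_, hlast, ?_, ?_, ?_, hgaps⟩
  · -- the other end is the source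
    have h1 : isEnd .vsrc (orientTo ν₀ .vsnk) = true := by
      rcases orientTo_eq_or ν₀ .vsnk with e | e
      · rw [e]; exact hsrc
      · rw [e, isEnd_reverse]; exact hsrc
    rcases isEnd_iff.1 h1 with h | h
    · exact h
    · rw [hlast] at h; exact absurd (Option.some.inj h).symm hne
  · intro x hx hxe
    rw [mem_orientTo] at hx
    refine hW.virt _ hν₀ x hx ?_
    rcases orientTo_eq_or ν₀ .vsnk with e | e <;> rw [e] at hxe
    · exact hxe
    · rwa [isEnd_reverse] at hxe
  · intro x hx; rw [mem_orientTo] at hx; exact hproc x ((hcells x).2 hx)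
  · intro p; rw [mem_cpairs_orientTo, ← hpairs' p]; exact hpairs p

/-! ### The three completion cases -/

/-- The gap counters certify `≥ 2` crossings when `gapsOK`. [folklore] -/
theorem Inv.two_le_hcount (hI : Inv l r0 cs u σ S) (hg : gapsOK σ.gaps = true) {k : ℕ} (hk : k + 1 < l) :
    2 ≤ hcount l cs u (k + 1) := by
  have := two_le_of_gapsOK hg (hI.gaps_eq k hk)
  exact le_trans this (min_le_right _ _)

/-- Uniqueness template: if every end pair of `S'` either is one of the two orientations of
`(x, y)` or comes from `S` with a real first component that is a coded frontier cell in a set of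
excluded columns whose frontier cells are also excluded, then every strand is the one containing
`x`. [folklore] -/
theorem unique_strand {S' : List (List XCell)} (hW' : WF (Adj l r0) S') {x y : XCell}
    {P : XCell → Prop}
    (hends : ∀ a b, (a, b) ∈ endPairs S' → ((a, b) ∈ endPairs S ∧ P a) ∨ a = x ∨ a = y)
    (hP : ∀ a b, (a, b) ∈ endPairs S → P a → False)
    {ν₀ : List XCell} (hν₀ : ν₀ ∈ S') (hx : x ∈ ν₀) (hy : y ∈ ν₀) : ∀ π ∈ S', π = ν₀ := by
  intro π hπ
  have hne : π ≠ [] := hW'.ne_nil π hπ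
  obtain ⟨a, ha⟩ : ∃ a, π.head? = some a := by cases π with | nil => exact absurd rfl hne | cons a t => exact ⟨a, rfl⟩
  obtain ⟨b, hb⟩ := exists_mem_epairs_of_isEnd (π := π) (a := a) (isEnd_iff.2 (Or.inl ha))
  have hab : (a, b) ∈ endPairs S' := mem_endPairs.2 ⟨π, hπ, hb⟩
  have haπ : a ∈ π := List.mem_of_mem_head? ha
  rcases hends a b hab with ⟨h1, h2⟩ | rfl | rfl
  · exact (hP a b h1 h2).elim
  · exact hW'.eq_of_mem hπ hν₀ haπ hx
  · exact hW'.eq_of_mem hπ hν₀ haπ hy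

/-- **Completion by `joinH`** (`stop src` meets `stop snk`). [cite: Jensen2004SAWLowerBounds, §2.1] -/
theorem final_joinH (hl : 2 ≤ l) (hu : u % 2 = 1) (hI : Inv l r0 cs u σ S)
    (he : joinH l (u / 2) σ (cs.getD u false) = .complete) :
    Final l r0 cs (u + 1) (finalStrand (gJoinH l (u / 2) σ S (cs.getD u false))) := by
  have hl0 : 0 < l := by omega
  have hc : u / 2 % l < l := Nat.mod_lt _ hl0
  -- only the stop/stop case with {src, snk} completes
  rcases Bool.eq_false_or_eq_true (cs.getD u false) with hcs | hcs <;> rw [hcs] at he ⊢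
  swap; · simp [joinH] at he
  by_cases hc0 : u / 2 % l = 0
  · simp [joinH, hc0] at he
  have hc1 : 1 ≤ u / 2 % l := Nat.pos_of_ne_zero hc0
  have hcm : u / 2 % l - 1 < l := by omega
  have hcs' : u / 2 % l < σ.slots.length := by rw [hI.len_slots]; exact hc
  have hcm' : u / 2 % l - 1 < σ.slots.length := by rw [hI.len_slots]; omega
  obtain ⟨a, ha⟩ : ∃ a, σ.slots[u / 2 % l - 1]? = some a := ⟨_, List.getElem?_eq_getElem hcm'⟩
  obtain ⟨b, hb⟩ : ∃ b, σ.slots[u / 2 % l]? = some b := ⟨_, List.getElem?_eq_getElem hcs'⟩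
  have key : ∃ ma mb, a = .stop ma ∧ b = .stop mb ∧ ¬ (ma = .col (u / 2 % l) ∨ mb = .col (u / 2 % l - 1)) ∧
      ((ma = .src ∧ mb = .snk) ∨ (ma = .snk ∧ mb = .src)) ∧
      othersClosed σ.slots [u / 2 % l - 1, u / 2 % l] = true ∧ gapsOK (bump σ.gaps (u / 2 % l - 1)) = true := by
    cases a with
    | inter => simp [joinH, hc0, ha] at he
    | empty => cases b <;> simp [joinH, hc0, ha, hb] at he
    | stop ma =>
      cases b with
      | inter => simp [joinH, hc0, ha, hb] at he
      | empty => simp [joinH, hc0, ha, hb] at he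
      | stop mb =>
        rw [joinH_stop_stop hc0 ha hb] at he
        by_cases hnd : ma = .col (u / 2 % l) ∨ mb = .col (u / 2 % l - 1)
        · rw [if_pos hnd] at he; cases he
        rw [if_neg hnd] at he
        by_cases hcomp : (ma = .src ∧ mb = .snk) ∨ (ma = .snk ∧ mb = .src)
        · rw [if_pos hcomp] at he
          exact ⟨ma, mb, rfl, rfl, hnd, hcomp, completeIf_eq_complete he⟩
        · rw [if_neg hcomp] at he; cases he
  obtain ⟨ma, mb, rfl, rfl, hnd, hcomp, hoc, hgok⟩ := key
  rw [gJoinH_stop_stop S ha hb]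
  push Not at hnd
  have hvf : cellOf l (u / 2) = front l u (u / 2 % l) := cellOf_eq_front hu
  have hlf : leftOf l (u / 2) = front l u (u / 2 % l - 1) := leftOf_eq_front hu
  have hA := adj_symm l r0
  have hlreal : (leftOf l (u / 2)).IsReal := by simp [leftOf, XCell.IsReal]
  have hvreal : (cellOf l (u / 2)).IsReal := by simp [cellOf, XCell.IsReal]
  have hlb : (leftOf l (u / 2), mateCell l u ma) ∈ endPairs S := (hI.ends _ _ hlreal).2 ⟨_, hcm, ma, ha, hlf, rfl⟩
  have hvb : (cellOf l (u / 2), mateCell l u mb) ∈ endPairs S := (hI.ends _ _ hvreal).2 ⟨_, hc, mb, hb, hvf, rfl⟩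
  have hfar : mateCell l u ma ≠ cellOf l (u / 2) := by
    intro e; rw [hvf] at e; exact hnd.1 (mate_eq_col_of_mateCell_eq_front e)
  obtain ⟨hW2, -, hcells2, hpairs2, hends2⟩ :=
    join_spec hI.wf hA hI.two_le hlb hvb (leftOf_ne_cellOf hc1) hfar hlreal hvreal (adj_leftOf_cellOf hc1)
  -- the merged strand contains both virtual vertices
  have hvirt : {mateCell l u ma, mateCell l u mb} = ({.vsrc, .vsnk} : Finset XCell) := by
    rcases hcomp with ⟨rfl, rfl⟩ | ⟨rfl, rfl⟩
    · rfl
    · simp only [mateCell]; rw [Finset.pair_comm]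
  have hsrcS : XCell.vsrc ∈ cells S := by
    have : XCell.vsrc ∈ ({mateCell l u ma, mateCell l u mb} : Finset XCell) := by rw [hvirt]; simp
    rcases Finset.mem_insert.1 this with h | h
    · rw [h]; exact mem_cells_of_mem_endPairs (endPairs_symm hlb)
    · rw [Finset.mem_singleton] at h; rw [h]; exact mem_cells_of_mem_endPairs (endPairs_symm hvb)
  have hsnkS : XCell.vsnk ∈ cells S := by
    have : XCell.vsnk ∈ ({mateCell l u ma, mateCell l u mb} : Finset XCell) := by rw [hvirt]; simp
    rcases Finset.mem_insert.1 this with h | h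
    · rw [h]; exact mem_cells_of_mem_endPairs (endPairs_symm hlb)
    · rw [Finset.mem_singleton] at h; rw [h]; exact mem_cells_of_mem_endPairs (endPairs_symm hvb)
  -- the strand of the merged family containing the left cell
  have hlcell : leftOf l (u / 2) ∈ cells (merge S (leftOf l (u / 2)) (cellOf l (u / 2))) := by
    rw [hcells2]; exact mem_cells_of_mem_endPairs hlb
  obtain ⟨ν₀, hν₀, hlν⟩ := mem_cells.1 hlcell
  -- ends of ν₀ are the two far ends, i.e. the two virtual vertices
  have hνends : (mateCell l u ma, mateCell l u mb) ∈ endPairs (merge S (leftOf l (u / 2)) (cellOf l (u / 2))) :=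
    (hends2 _ _).2 (Or.inr (Or.inl ⟨rfl, rfl⟩))
  obtain ⟨π₁, hπ₁, hep⟩ := mem_endPairs.1 hνends
  -- π₁ = ν₀: both contain the left cell? π₁ contains mateCell ma; use uniqueness below instead
  have huniq : ∀ π ∈ merge S (leftOf l (u / 2)) (cellOf l (u / 2)), π = π₁ := by
    refine unique_strand hW2 (S := S) (x := mateCell l u ma) (y := mateCell l u mb)
      (P := fun a => a ≠ leftOf l (u / 2) ∧ a ≠ mateCell l u ma ∧ a ≠ cellOf l (u / 2) ∧ a ≠ mateCell l u mb)
      ?_ ?_ hπ₁ (mem_of_isEnd (isEnd_of_mem_epairs hep)) ?_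
    · intro a' b' h
      rcases (hends2 a' b').1 h with ⟨h1, h2, h3, h4, h5⟩ | ⟨rfl, -⟩ | ⟨rfl, -⟩
      · exact Or.inl ⟨h1, h2, h3, h4, h5⟩
      · exact Or.inr (Or.inl rfl)
      · exact Or.inr (Or.inr rfl)
    · rintro a' b' hab ⟨h1, h2, h3, h4⟩
      -- a' is a real end (the virtual ones are the far ends) hence a coded frontier cell
      have hreal : a'.IsReal := by
        have hmem := mem_cells_of_mem_endPairs hab
        cases a' with
        | cell _ _ => trivial
        | vsrc =>
          exfalso
          have : XCell.vsrc ∈ ({mateCell l u ma, mateCell l u mb} : Finset XCell) := by rw [hvirt]; simp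
          simp only [Finset.mem_insert, Finset.mem_singleton] at this
          rcases this with h | h; exact h2 h; exact h4 h
        | vsnk =>
          exfalso
          have : XCell.vsnk ∈ ({mateCell l u ma, mateCell l u mb} : Finset XCell) := by rw [hvirt]; simp
          simp only [Finset.mem_insert, Finset.mem_singleton] at this
          rcases this with h | h; exact h2 h; exact h4 h
      obtain ⟨k, hk, m, hkm, rfl, -⟩ := (hI.ends _ _ hreal).1 hab
      refine not_stop_of_othersClosed hoc (i := k) ?_ hkm
      simp only [List.mem_cons, List.not_mem_nil, or_false, not_or]
      exact ⟨fun e => h1 (by rw [e, hlf]), fun e => h3 (by rw [e, hvf])⟩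
    · rcases mem_epairs.1 hep with ⟨-, h⟩ | ⟨h, -⟩
      · exact List.mem_of_getLast? h
      · exact List.mem_of_mem_head? h
  have hsrc1 : isEnd .vsrc π₁ = true := by
    have hmem : XCell.vsrc ∈ π₁ := by
      obtain ⟨π, hπ, hx⟩ := mem_cells.1 (show XCell.vsrc ∈ cells (merge S _ _) by rw [hcells2]; exact hsrcS)
      rwa [huniq π hπ] at hx
    by_contra h; exact absurd (hW2.virt _ hπ₁ _ hmem (by simpa using h)) (by simp [XCell.IsReal])
  have hsnk1 : isEnd .vsnk π₁ = true := by
    have hmem : XCell.vsnk ∈ π₁ := by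
      obtain ⟨π, hπ, hx⟩ := mem_cells.1 (show XCell.vsnk ∈ cells (merge S _ _) by rw [hcells2]; exact hsnkS)
      rwa [huniq π hπ] at hx
    by_contra h; exact absurd (hW2.virt _ hπ₁ _ hmem (by simpa using h)) (by simp [XCell.IsReal])
  refine final_of_unique hW2 hπ₁ hsrc1 hsnk1 huniq ?_ ?_ ?_
  · intro x hx; rw [hcells2] at hx; exact (processed_succ_odd hu _).2 (hI.processed x hx)
  · intro p
    rw [hpairs2, Nat.exists_lt_succ_right, potEdge_of_odd hu, hcs, Finset.mem_insert]
    simp only [true_and]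
    constructor
    · rintro ⟨rfl | hp, hreal⟩
      · exact Or.inr rfl
      · exact Or.inl ((hI.pairs_iff p).1 ⟨hp, hreal⟩)
    · rintro (h | rfl)
      · obtain ⟨hp, hreal⟩ := (hI.pairs_iff p).2 h; exact ⟨Or.inr hp, hreal⟩
      · exact ⟨Or.inl rfl, Sym2.ball.2 ⟨hlreal, hvreal⟩⟩
  · intro k hk
    rw [hcount_succ_of_odd hu, hcs]
    have hb' := getElem?_bump σ.gaps (u / 2 % l - 1) k
    rw [hI.gaps_eq k hk] at hb'
    by_cases hk1 : u / 2 % l - 1 = k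
    · rw [if_pos hk1, Option.map_some] at hb'
      have hg := two_le_of_gapsOK hgok hb'
      rw [if_pos ⟨by omega, rfl⟩]; omega
    · rw [if_neg hk1] at hb'
      have hg := two_le_of_gapsOK hgok hb'
      rw [if_neg (by rintro ⟨h, -⟩; omega)]; omega

/-- `advance`, case `stop snk`/edge at the start cell (completion or death). [folklore] -/
theorem advance_stop_snk_true_start {t : ℕ} {σ : State} (h : σ.slots[t % l]? = some (Code.stop .snk))
    (hst : isStart l r0 t = true) :
    advance l r0 t σ true = completeIf (othersClosed σ.slots [t % l]) σ.gaps := by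
  simp only [advance, h, Option.getD_some, hst]
  rfl

/-- `advance`, case `stop src`/no edge (completion or death). [folklore] -/
theorem advance_stop_src_false {t : ℕ} {σ : State} (h : σ.slots[t % l]? = some (Code.stop .src)) :
    advance l r0 t σ false =
      if t % l + 1 = l ∧ σ.sink = false then completeIf (othersClosed σ.slots [t % l] && !isStart l r0 t) σ.gaps
      else .dead := by
  simp only [advance, h, Option.getD_some]

/-- **Completion by `advance` through a vertical edge into the start cell** (the strand ending
below has the sink at its far end). [cite: Jensen2004SAWLowerBounds, §2.1] -/
theorem final_advance_true (hl : 2 ≤ l) (hu : u % 2 = 0) (hI : Inv l r0 cs u σ S)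
    (hcs : cs.getD u false = true) (he : advance l r0 (u / 2) σ true = .complete) :
    Final l r0 cs (u + 1) (finalStrand (gAdvance l r0 (u / 2) σ S true)) := by
  have hl0 : 0 < l := by omega
  have hc : u / 2 % l < l := Nat.mod_lt _ hl0
  have hcs' : u / 2 % l < σ.slots.length := by rw [hI.len_slots]; exact hc
  obtain ⟨code, hcode⟩ : ∃ code, σ.slots[u / 2 % l]? = some code := ⟨_, List.getElem?_eq_getElem hcs'⟩
  -- only `stop snk` at the start cell completes
  have key : code = .stop .snk ∧ isStart l r0 (u / 2) = true ∧
      othersClosed σ.slots [u / 2 % l] = true ∧ gapsOK σ.gaps = true := by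
    cases code with
    | empty => rw [advance_empty_true l r0 hcode] at he; split_ifs at he
    | inter => rw [advance_inter_true l r0 hcode] at he; cases he
    | stop m =>
      rcases Bool.eq_false_or_eq_true (isStart l r0 (u / 2)) with hst | hst
      · cases m with
        | col k => rw [advance_stop_true_start l r0 hcode hst] at he; cases he
        | src => rw [advance_stop_src_true_start l r0 hcode hst] at he; cases he
        | snk => rw [advance_stop_snk_true_start hcode hst] at he; exact ⟨rfl, hst, completeIf_eq_complete he⟩
      · rw [advance_stop_true l r0 hcode hst] at he; cases he
  obtain ⟨rfl, hst, hoc, hgok⟩ := key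
  rw [gAdvance_stop_true l r0 S hcode, if_pos hst]
  have hdf : below l (u / 2) = front l u (u / 2 % l) := below_eq_front hu
  have hvnot : cellOf l (u / 2) ∉ cells S := fun h => not_processed_cellOf hu hl0 (hI.processed _ h)
  have hA := adj_symm l r0
  have hdreal : (below l (u / 2)).IsReal := by simp [below, XCell.IsReal]
  have hvreal : (cellOf l (u / 2)).IsReal := by simp [cellOf, XCell.IsReal]
  have hdb : (below l (u / 2), XCell.vsnk) ∈ endPairs S := (hI.ends _ _ hdreal).2 ⟨_, hc, _, hcode, hdf, rfl⟩
  obtain ⟨hW1, h2le1, hcells1, hpairs1, hends1⟩ :=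
    extend_spec hI.wf hA hI.two_le hdb hdreal hvnot (adj_below_cellOf (u / 2))
  have hvsrcS : XCell.vsrc ∉ cells S := by rw [hI.vsrc_mem]; exact (src_time_of_start hu hl0 hst).2
  have hvsrc : XCell.vsrc ∉ cells (merge (S ++ [[cellOf l (u / 2)]]) (below l (u / 2)) (cellOf l (u / 2))) := by
    rw [hcells1, Finset.mem_insert, not_or]; exact ⟨by simp [cellOf], hvsrcS⟩
  have hvb : (cellOf l (u / 2), XCell.vsnk) ∈ endPairs (merge (S ++ [[cellOf l (u / 2)]]) (below l (u / 2)) (cellOf l (u / 2))) :=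
    (hends1 _ _).2 (Or.inr (Or.inr ⟨rfl, rfl⟩))
  obtain ⟨hW2, -, hcells2, hpairs2, hends2⟩ := extend_spec hW1 hA h2le1 hvb hvreal hvsrc (adj_cellOf_vsrc hl0 hst)
  -- the strand with the two virtual ends
  have hνends : (XCell.vsnk, XCell.vsrc) ∈ endPairs (merge (merge (S ++ [[cellOf l (u / 2)]]) (below l (u / 2))
      (cellOf l (u / 2)) ++ [[.vsrc]]) (cellOf l (u / 2)) .vsrc) := (hends2 _ _).2 (Or.inr (Or.inl ⟨rfl, rfl⟩))
  obtain ⟨π₁, hπ₁, hep⟩ := mem_endPairs.1 hνends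
  have hsnk1 : isEnd .vsnk π₁ = true := isEnd_of_mem_epairs hep
  have hsrc1 : isEnd .vsrc π₁ = true := by
    rw [isEnd_iff]; rcases mem_epairs.1 hep with ⟨-, h⟩ | ⟨h, -⟩; exact Or.inr h; exact Or.inl h
  have huniq : ∀ π ∈ merge (merge (S ++ [[cellOf l (u / 2)]]) (below l (u / 2)) (cellOf l (u / 2)) ++ [[.vsrc]])
      (cellOf l (u / 2)) .vsrc, π = π₁ := by
    refine unique_strand hW2 (S := S) (x := .vsnk) (y := .vsrc)
      (P := fun a => a ≠ below l (u / 2) ∧ a ≠ .vsnk ∧ a ≠ cellOf l (u / 2)) ?_ ?_ hπ₁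
      (mem_of_isEnd hsnk1) (mem_of_isEnd hsrc1)
    · intro a' b' h
      rcases (hends2 a' b').1 h with ⟨h1, h2, h3⟩ | ⟨rfl, -⟩ | ⟨rfl, -⟩
      · rcases (hends1 a' b').1 h1 with ⟨h4, h5, h6⟩ | ⟨rfl, -⟩ | ⟨rfl, -⟩
        · exact Or.inl ⟨h4, h5, h6, h2⟩
        · exact absurd rfl h3
        · exact absurd rfl h2
      · exact Or.inr (Or.inl rfl)
      · exact Or.inr (Or.inr rfl)
    · rintro a' b' hab ⟨h1, h2, h3⟩
      have hreal : a'.IsReal := by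
        have hmem := mem_cells_of_mem_endPairs hab
        cases a' with
        | cell _ _ => trivial
        | vsrc => exact absurd hmem hvsrcS
        | vsnk => exact absurd rfl h2
      obtain ⟨k, hk, m, hkm, rfl, -⟩ := (hI.ends _ _ hreal).1 hab
      refine not_stop_of_othersClosed hoc (i := k) ?_ hkm
      simp only [List.mem_cons, List.not_mem_nil, or_false]
      exact fun e => h1 (by rw [e, hdf])
  refine final_of_unique hW2 hπ₁ hsrc1 hsnk1 huniq ?_ ?_ ?_
  · intro x hx
    rw [hcells2, hcells1] at hx; simp only [Finset.mem_insert] at hx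
    rcases hx with rfl | rfl | hx
    · trivial
    · exact (processed_succ_even hu hl0 _).2 (Or.inr rfl)
    · exact (processed_succ_even hu hl0 _).2 (Or.inl (hI.processed x hx))
  · intro p
    rw [hpairs2, hpairs1, Nat.exists_lt_succ_right, potEdge_of_even hu, hcs, Finset.mem_insert, Finset.mem_insert]
    simp only [true_and]
    constructor
    · rintro ⟨rfl | rfl | hp, hreal⟩
      · exact absurd (Sym2.ball.1 hreal).2 (by simp [XCell.IsReal])
      · exact Or.inr rfl
      · exact Or.inl ((hI.pairs_iff p).1 ⟨hp, hreal⟩)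
    · rintro (h | rfl)
      · obtain ⟨hp, hreal⟩ := (hI.pairs_iff p).2 h; exact ⟨Or.inr (Or.inr hp), hreal⟩
      · exact ⟨Or.inr (Or.inl rfl), Sym2.ball.2 ⟨hdreal, hvreal⟩⟩
  · intro k hk; rw [hcount_succ_of_even hu]; exact hI.two_le_hcount hgok hk

/-- **Completion by `advance` without edge** (the open end below, whose far end is the source, is
abandoned as the end of the bridge). [cite: Jensen2004SAWLowerBounds, §2.1] -/
theorem final_advance_false (hl : 2 ≤ l) (hu : u % 2 = 0) (hI : Inv l r0 cs u σ S)
    (hcs : cs.getD u false = false) (he : advance l r0 (u / 2) σ false = .complete) :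
    Final l r0 cs (u + 1) (finalStrand (gAdvance l r0 (u / 2) σ S false)) := by
  have hl0 : 0 < l := by omega
  have hc : u / 2 % l < l := Nat.mod_lt _ hl0
  have hcs' : u / 2 % l < σ.slots.length := by rw [hI.len_slots]; exact hc
  obtain ⟨code, hcode⟩ : ∃ code, σ.slots[u / 2 % l]? = some code := ⟨_, List.getElem?_eq_getElem hcs'⟩
  have key : code = .stop .src ∧ u / 2 % l + 1 = l ∧ σ.sink = false ∧
      othersClosed σ.slots [u / 2 % l] = true ∧ isStart l r0 (u / 2) = false ∧ gapsOK σ.gaps = true := by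
    cases code with
    | empty => rw [advance_empty_false l r0 hcode] at he; cases he
    | inter => rw [advance_inter_false l r0 hcode] at he; cases he
    | stop m =>
      cases m with
      | col k => rw [advance_stop_col_false l r0 hcode] at he; split_ifs at he
      | snk => rw [advance_stop_snk_false l r0 hcode] at he; cases he
      | src =>
        rw [advance_stop_src_false hcode] at he
        by_cases hcond : u / 2 % l + 1 = l ∧ σ.sink = false
        · rw [if_pos hcond] at he
          obtain ⟨h1, h2⟩ := completeIf_eq_complete he
          rw [Bool.and_eq_true, Bool.not_eq_true'] at h1
          exact ⟨rfl, hcond.1, hcond.2, h1.1, h1.2, h2⟩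
        · rw [if_neg hcond] at he; cases he
  obtain ⟨rfl, hcl, hsink, hoc, hst, hgok⟩ := key
  rw [gAdvance_stop_false l r0 S hcode, if_neg (by rw [hst]; exact Bool.false_ne_true)]
  have hdf : below l (u / 2) = front l u (u / 2 % l) := below_eq_front hu
  have hA := adj_symm l r0
  have hdreal : (below l (u / 2)).IsReal := by simp [below, XCell.IsReal]
  have hdb : (below l (u / 2), XCell.vsrc) ∈ endPairs S := (hI.ends _ _ hdreal).2 ⟨_, hc, _, hcode, hdf, rfl⟩
  have hvsnkS : XCell.vsnk ∉ cells S := by rw [hI.vsnk_mem, hsink]; simp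
  obtain ⟨hW1, -, hcells1, hpairs1, hends1⟩ :=
    extend_spec hI.wf hA hI.two_le hdb hdreal hvsnkS (adj_below_vsnk hcl)
  have hνends : (XCell.vsrc, XCell.vsnk) ∈ endPairs (merge (S ++ [[.vsnk]]) (below l (u / 2)) .vsnk) :=
    (hends1 _ _).2 (Or.inr (Or.inl ⟨rfl, rfl⟩))
  obtain ⟨π₁, hπ₁, hep⟩ := mem_endPairs.1 hνends
  have hsrc1 : isEnd .vsrc π₁ = true := isEnd_of_mem_epairs hep
  have hsnk1 : isEnd .vsnk π₁ = true := by
    rw [isEnd_iff]; rcases mem_epairs.1 hep with ⟨-, h⟩ | ⟨h, -⟩; exact Or.inr h; exact Or.inl h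
  have huniq : ∀ π ∈ merge (S ++ [[.vsnk]]) (below l (u / 2)) .vsnk, π = π₁ := by
    refine unique_strand hW1 (S := S) (x := .vsrc) (y := .vsnk)
      (P := fun a => a ≠ below l (u / 2) ∧ a ≠ .vsrc) ?_ ?_ hπ₁ (mem_of_isEnd hsrc1) (mem_of_isEnd hsnk1)
    · intro a' b' h
      rcases (hends1 a' b').1 h with ⟨h1, h2, h3⟩ | ⟨rfl, -⟩ | ⟨rfl, -⟩
      · exact Or.inl ⟨h1, h2, h3⟩
      · exact Or.inr (Or.inl rfl)
      · exact Or.inr (Or.inr rfl)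
    · rintro a' b' hab ⟨h1, h2⟩
      have hreal : a'.IsReal := by
        have hmem := mem_cells_of_mem_endPairs hab
        cases a' with
        | cell _ _ => trivial
        | vsrc => exact absurd rfl h2
        | vsnk => exact absurd hmem hvsnkS
      obtain ⟨k, hk, m, hkm, rfl, -⟩ := (hI.ends _ _ hreal).1 hab
      refine not_stop_of_othersClosed hoc (i := k) ?_ hkm
      simp only [List.mem_cons, List.not_mem_nil, or_false]
      exact fun e => h1 (by rw [e, hdf])
  refine final_of_unique hW1 hπ₁ hsrc1 hsnk1 huniq ?_ ?_ ?_
  · intro x hx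
    rw [hcells1, Finset.mem_insert] at hx
    rcases hx with rfl | hx
    · trivial
    · exact (processed_succ_even hu hl0 _).2 (Or.inl (hI.processed x hx))
  · intro p
    rw [hpairs1, Nat.exists_lt_succ_right, hcs, Finset.mem_insert]
    simp only [Bool.false_eq_true, false_and, or_false]
    constructor
    · rintro ⟨rfl | hp, hreal⟩
      · exact absurd (Sym2.ball.1 hreal).2 (by simp [XCell.IsReal])
      · exact (hI.pairs_iff p).1 ⟨hp, hreal⟩
    · intro h; obtain ⟨hp, hreal⟩ := (hI.pairs_iff p).2 h; exact ⟨Or.inr hp, hreal⟩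
  · intro k hk; rw [hcount_succ_of_even hu]; exact hI.two_le_hcount hgok hk

/-- **Completion of a micro-step yields the final strand.** [cite: Jensen2004SAWLowerBounds, §2.1] -/
theorem final_step (hl : 2 ≤ l) (hI : Inv l r0 cs u σ S) (he : step l r0 u σ (cs.getD u false) = .complete) :
    Final l r0 cs (u + 1) (finalStrand (gstep l r0 u σ S (cs.getD u false))) := by
  unfold step at he; unfold gstep
  by_cases hu : u % 2 = 0
  · rw [if_pos hu] at he ⊢
    rcases Bool.eq_false_or_eq_true (cs.getD u false) with hcs | hcs <;> rw [hcs] at he ⊢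
    · exact final_advance_true hl hu hI hcs he
    · exact final_advance_false hl hu hI hcs he
  · rw [if_neg hu] at he ⊢; exact final_joinH hl (by omega) hI he

end StripTM

end Literature.Probability.RandomPlanarGeometry.SAW
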